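import Mathlib.Data.Finset.Card
import Mathlib.Data.Finset.Powerset
import Mathlib.Algebra.BigOperators.Group.Finset.Sigma
import Mathlib.Algebra.BigOperators.Group.Finset.Piecewise
import Mathlib.Algebra.Order.BigOperators.Group.Finset
import Mathlib.Algebra.Group.Action.Defs
import Mathlib.Algebra.BigOperators.Ring.Finset
import HarnessLib

/-!
# The face sum identity over k-faces and two five-coordinate double counts of N7F §3.11

Cell `pub-hsemireg`, widening group W5, seat w5-n7-1 (gen 10); files of record
`widen/W5/N7-FEASIBILITY-w5n7.md` (N7F) §3.11 (b)(d) and `widen/W5/TABLE-W5-N7.md` row N7-23. HONEST FRAMING: pure finite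
counting. Objects `i ∈ M` carry a 2-element support `supp i` (a pair of coordinates — a deuce–deuce torus type, a
hub→deuce slot, a hub–hub torus) and a weight `c i : ℕ`. Summing, over the k-coordinate faces `T` of a face `S`,
the total weight supported inside `T` counts every object supported inside `S` exactly `C(#S − 2, k − 2)` times.
Corollaries at `#S = 5`: (§3.11 (b) STEP 1) no weights can give total exactly 2 on EVERY 3-face — `3 · Σ = 10 · 2`;
(§3.11 (d)) the 4-face totals add up to `3 ·` the total, so a per-4-face bound `d` bounds the total by `5d/3`. The
reductions of record (HD-complete ∅-faces ⇒ «exactly two deuce–deuce tori counted on every triple»; «missing hub→deuce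
slots») are NOT formalised — they are the hypotheses. Nothing here is a statement about any variety, sheaf or class,
and nothing here bears on HC / HC_CM / HC_AV.

* `card_filter_powersetCard_supset` — a 2-set `p ⊆ S` lies in exactly `C(#S − 2, k − 2)` of the k-faces of `S`.
* `sum_powersetCard_sum_filter_supp_subset` — the FACE SUM IDENTITY over k-faces (weighted).
* `false_of_three_faces_sum_eq_two` — §3.11 (b) STEP 1: `#S = 5`, every 3-face total `= 2` ⇒ False.
* `three_mul_card_le_of_four_faces` — §3.11 (d): `#S = 5`, every 4-face holds ≤ `d` objects ⇒ `3 · #(inside S) ≤ 5 · d`.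
-/

open Finset

namespace Summit.Ventures.HSemireg.StarFamilyFaceSumBinomial

variable {ι V : Type*} [DecidableEq V]

/-- A 2-element set `p ⊆ S` is contained in exactly `C(#S − 2, k − 2)` of the `k`-element subsets of `S`
(`2 ≤ k`): `T ↦ T \ p` is a bijection onto the `(k − 2)`-subsets of `S \ p`. -/
theorem card_filter_powersetCard_supset {S p : Finset V} (hp : p ⊆ S) (hp2 : p.card = 2) {k : ℕ}
    (hk : 2 ≤ k) :
    #{T ∈ S.powersetCard k | p ⊆ T} = (S.card - 2).choose (k - 2) := by
  rw [← hp2, ← card_sdiff_of_subset hp, ← card_powersetCard]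
  symm
  refine card_bij' (fun U _ => U ∪ p) (fun T _ => T \ p) ?_ ?_ ?_ ?_
  · intro U hU
    rw [mem_powersetCard] at hU
    have hdisj : Disjoint U p := by
      rw [subset_sdiff] at hU
      exact hU.1.2
    rw [mem_filter, mem_powersetCard]
    refine ⟨⟨union_subset (hU.1.trans sdiff_subset) hp, ?_⟩, subset_union_right⟩
    rw [card_union_of_disjoint hdisj, hU.2, hp2]
    omega
  · intro T hT
    rw [mem_filter, mem_powersetCard] at hT
    rw [mem_powersetCard]
    refine ⟨sdiff_subset_sdiff hT.1.1 le_rfl, ?_⟩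
    rw [card_sdiff_of_subset hT.2, hT.1.2, hp2]
  · intro U hU
    rw [mem_powersetCard, subset_sdiff] at hU
    exact union_sdiff_cancel_right hU.1.2
  · intro T hT
    rw [mem_filter] at hT
    exact sdiff_union_of_subset hT.2

/-- **FACE SUM IDENTITY over k-faces (weighted).** If every object of `M` is supported on exactly two coordinates,
then for `2 ≤ k`
`∑_{T ⊆ S, #T = k} ∑_{i ∈ M, supp i ⊆ T} c i = C(#S − 2, k − 2) · ∑_{i ∈ M, supp i ⊆ S} c i`. -/
theorem sum_powersetCard_sum_filter_supp_subset (M : Finset ι) (supp : ι → Finset V) (c : ι → ℕ)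
    (hM : ∀ i ∈ M, (supp i).card = 2) (S : Finset V) {k : ℕ} (hk : 2 ≤ k) :
    ∑ T ∈ S.powersetCard k, ∑ i ∈ M with supp i ⊆ T, c i
      = (S.card - 2).choose (k - 2) * ∑ i ∈ M with supp i ⊆ S, c i := by
  calc ∑ T ∈ S.powersetCard k, ∑ i ∈ M with supp i ⊆ T, c i
      = ∑ T ∈ S.powersetCard k, ∑ i ∈ M, (if supp i ⊆ T then c i else 0) := by
        refine sum_congr rfl fun T _ => ?_
        rw [sum_filter]
    _ = ∑ i ∈ M, ∑ T ∈ S.powersetCard k, (if supp i ⊆ T then c i else 0) := sum_comm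
    _ = ∑ i ∈ M, #{T ∈ S.powersetCard k | supp i ⊆ T} * c i := by
        refine sum_congr rfl fun i _ => ?_
        rw [← sum_filter, sum_const, smul_eq_mul]
    _ = ∑ i ∈ M, (if supp i ⊆ S then (S.card - 2).choose (k - 2) * c i else 0) := by
        refine sum_congr rfl fun i hi => ?_
        split_ifs with h
        · rw [card_filter_powersetCard_supset h (hM i hi) hk]
        · have h0 : ({T ∈ S.powersetCard k | supp i ⊆ T} : Finset (Finset V)) = ∅ := by
            rw [filter_eq_empty_iff]
            intro T hT hiT
            rw [mem_powersetCard] at hT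
            exact h (hiT.trans hT.1)
          rw [h0, card_empty, Nat.zero_mul]
    _ = (S.card - 2).choose (k - 2) * ∑ i ∈ M with supp i ⊆ S, c i := by
        rw [← sum_filter, mul_sum]

/-- **N7F §3.11 (b) STEP 1 (the `3 · Σc = 20` double count).** On a 5-coordinate face `S` no system of weights
on objects with 2-element support can have total EXACTLY 2 inside every 3-face: summing over the ten 3-faces gives
`20 = 3 · (total inside S)`. (In the cell: with HD-complete ∅-faces every deuce–deuce torus of a triple is counted
once in its triangle number `T = 2`, so `c_xy + c_xz + c_yz = 2` on all ten triples — impossible.) -/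
theorem false_of_three_faces_sum_eq_two (M : Finset ι) (supp : ι → Finset V) (c : ι → ℕ)
    (hM : ∀ i ∈ M, (supp i).card = 2) {S : Finset V} (hS : S.card = 5)
    (h3 : ∀ T ∈ S.powersetCard 3, ∑ i ∈ M with supp i ⊆ T, c i = 2) :
    False := by
  have hsum := sum_powersetCard_sum_filter_supp_subset M supp c hM S (k := 3) (by omega)
  rw [sum_congr rfl h3, sum_const, smul_eq_mul, card_powersetCard, hS] at hsum
  have h10 : Nat.choose 5 3 = 10 := by decide
  have h3' : Nat.choose (5 - 2) (3 - 2) = 3 := by decide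
  rw [h10, h3'] at hsum
  omega

/-- **N7F §3.11 (d) (the face bound on the total defect).** On a 5-coordinate face `S`, the numbers of objects
supported inside the five 4-faces add up to `3 ·` the number supported inside `S` (each 2-element support lies in
three of the five 4-faces); hence if every 4-face holds at most `d` of them, `3 · #(inside S) ≤ 5 · d` — «global
defect ≤ ⌊5d/3⌋». -/
theorem three_mul_card_le_of_four_faces (M : Finset ι) (supp : ι → Finset V)
    (hM : ∀ i ∈ M, (supp i).card = 2) {S : Finset V} (hS : S.card = 5) {d : ℕ}
    (h4 : ∀ T ∈ S.powersetCard 4, #{i ∈ M | supp i ⊆ T} ≤ d) :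
    3 * #{i ∈ M | supp i ⊆ S} ≤ 5 * d := by
  have hsum := sum_powersetCard_sum_filter_supp_subset M supp (fun _ => 1) hM S (k := 4) (by omega)
  simp only [sum_const, smul_eq_mul, mul_one] at hsum
  rw [hS, show Nat.choose (5 - 2) (4 - 2) = 3 by decide] at hsum
  have hle : ∑ T ∈ S.powersetCard 4, #{i ∈ M | supp i ⊆ T} ≤ #(S.powersetCard 4) * d :=
    sum_le_card_nsmul _ _ _ h4 |>.trans_eq (by rw [smul_eq_mul])
  rw [card_powersetCard, hS, show Nat.choose 5 4 = 5 by decide] at hle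
  omega

end Summit.Ventures.HSemireg.StarFamilyFaceSumBinomial
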